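import Summits.ValiantsHypothesis.ValiantsHypothesis.Theorems.KPlusLogSqLawTropicalBThreeRowEightFamily

/-!
# Route «KPlusLogSqLaw», crux `TropicalB` (stmt-ValiantsHypothesis-19771) — the `m = 3` tropical row for ALL `K`, SIGNED:
# `T(3,K) ≥ 8K − 33` (eight sign changes per class level along the self-similar family `ThreeRowEight`)

HONEST FRAMING.  Helper file (cell `pub-symmetroid`, seat val-sym-trop-p3 (g5), 2026-08-27) for the registered stubs of the OPEN crux
`TropicalB`; a SMALL-FORMAT census row (`m = 3`, every `K`) in the super-fat corner, far off the crux window.  Nothing here bears on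
`TropicalB` in its window, `WeakLifting`, the doors, `MatrixDescartes` (stmt-ValiantsHypothesis-18050) or VP ≠ VNP; a FLOOR refutes no law.

WHAT IS PROVED.  The family of `…ThreeRowEightDefs` / `…ThreeRowEightFamily` (rail `4^l`, `v = (ψ + 1536 l − 512)·4^l`, entry `(0,2)` absent,
eight uniquely dominant terms per class level, all `K ≥ 5`) carries the periodic sign pattern `ε(a,b,l) = (−1)^(s(a,b) + t(a,b)·l)` (`es`;
`s = 1` on `(1,1), (2,1), (2,2)`, `t = 1` on `(0,1), (1,1), (1,2), (2,1), (2,2)`) under which the term sign of phase `j` is `(−1)^(j+1)` at EVERY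
level (`termSign_phase`: the parity bits of each phase's three cells sum to an even number, so the level cancels), hence consecutive terms
alternate (`threeRowEight_alternating`) and

* **`not_tropRootLawAt_three_family (K') : ¬ TropRootLawAt 3 (K' + 5) (8·K' + 6)`** — the `(3,K)` tropical row satisfies
  **`T(3,K) ≥ 8K − 33` for every `K ≥ 5`** (row of record before: `6K − 11 ≤ T(3,K)` located / `6K − 9` for `K ≤ 10` in kernel via the
  symmetric rail; ceilings `18K − 53` (`…ThreeRowSharp`) and `⌊(27K − 17)/2⌋` (`…HalfThin`)).  The asymptotic slope of the `m = 3` row is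
  therefore in `[8, 13.5]` IN THE KERNEL (located: `≥ 9` signed / `≥ 10` unsigned along a denser word, `…ThreeRowTen`).

Dominance is transported from the unsigned design along equal supports (`isDominant_of_support`); only the sign bookkeeping is new here.
[this seat's construction; the rows are the cell's definitions; no citation exists]
-/

set_option linter.dupNamespace false
set_option autoImplicit false

namespace Summit.ValiantsHypothesis.ValiantsHypothesis.Theorems.KPlusLogSqLaw

open Summit.ValiantsHypothesis.ValiantsHypothesis.Theorems.MatrixDescartes.Negative
open Summit.ValiantsHypothesis.ValiantsHypothesis.Theorems.LacunarySymmetroidMatrixDescartes.TropicalCensus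

namespace ThreeRowEight

/-! ## 5. Signs: a periodic pattern making the chain alternate -/

/-- sign offsets `s(a,b)`. -/
def sb : Fin 3 → Fin 3 → ℕ := ![![0, 0, 0], ![0, 1, 0], ![0, 1, 1]]

/-- class-parity bits `t(a,b)`: `ε(a,b,l) = (−1)^(s + t·l)`. -/
def tb : Fin 3 → Fin 3 → ℕ := ![![0, 1, 0], ![0, 1, 1], ![0, 1, 1]]

/-- the signed design: `ε(a,b,l) = (−1)^(s(a,b) + t(a,b)·l)` on the present cells, `0` on the absent cell `(0,2)`. -/
def es (K : ℕ) : Fin 3 → Fin 3 → Fin K → ℤ :=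
  fun a b l => if a = 0 ∧ b = 2 then 0 else (-1) ^ (sb a b + tb a b * (l : ℕ))

/-- the term signs of the eight phases (independent of the level). -/
def chi : Fin 8 → ℤ := ![(-1 : ℤ), 1, (-1 : ℤ), 1, (-1 : ℤ), 1, (-1 : ℤ), 1]

/-- the template permutations as value tables (`col ↦ row`). -/
def sgv : Fin 8 → Fin 3 → Fin 3 := ![![1, 0, 2], ![2, 0, 1], ![2, 0, 1], ![2, 0, 1], ![0, 2, 1], ![0, 1, 2], ![0, 1, 2], ![0, 2, 1]]

/-- signs of the template permutations. -/
def sgn : Fin 8 → ℤ := ![(-1 : ℤ), 1, 1, 1, (-1 : ℤ), 1, 1, (-1 : ℤ)]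

/-- `sg` evaluates to the table `sgv`. -/
theorem sg_apply : ∀ (j : Fin 8) (i : Fin 3), sg j i = sgv j i := by decide

/-- the signs of the template permutations. -/
theorem sign_sg : ∀ j : Fin 8, (Equiv.Perm.sign (sg j) : ℤ) = sgn j := by decide

/-- a Leibniz term is present iff all its ports are. [definition unfolding] -/
theorem termSign_ne_zero_iff {m K : ℕ} (ε : Fin m → Fin m → Fin K → ℤ) (p : Equiv.Perm (Fin m) × (Fin m → Fin K)) :
    termSign ε p ≠ 0 ↔ ∀ i, ε (p.1 i) i (p.2 i) ≠ 0 := by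
  unfold termSign
  rw [mul_ne_zero_iff, Finset.prod_ne_zero_iff]
  simp

/-- dominance only sees the support of the sign pattern. [definition unfolding] -/
theorem isDominant_of_support {m K : ℕ} (d : Fin K → ℕ) (v : Fin m → Fin m → Fin K → ℤ) (ε ε' : Fin m → Fin m → Fin K → ℤ)
    (h : ∀ a b l, ε a b l = 0 ↔ ε' a b l = 0) (θ : ℤ) (p : Equiv.Perm (Fin m) × (Fin m → Fin K))
    (hp : IsDominant d v ε θ p) : IsDominant d v ε' θ p := by
  obtain ⟨h1, h2⟩ := hp
  refine ⟨?_, ?_⟩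
  · rw [termSign_ne_zero_iff] at h1 ⊢
    intro i hi; exact h1 i ((h _ _ _).mpr hi)
  · intro p' hp' hs
    apply h2 p' hp'
    rw [termSign_ne_zero_iff] at hs ⊢
    intro i hi; exact hs i ((h _ _ _).mp hi)

/-- the two sign patterns have the same support. -/
theorem es_zero_iff (K : ℕ) (a b : Fin 3) (l : Fin K) : ee K a b l = 0 ↔ es K a b l = 0 := by
  simp only [ee, es]
  by_cases hab : a = 0 ∧ b = 2
  · simp [hab]
  · rw [if_neg hab, if_neg hab]
    constructor
    · intro h; norm_num at h
    · intro h
      exact absurd h (pow_ne_zero _ (by norm_num))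

/-- signs are in `{0, ±1}`. -/
theorem es_natAbs_le (K : ℕ) (a b : Fin 3) (l : Fin K) : (es K a b l).natAbs ≤ 1 := by
  simp only [es]
  split_ifs
  · simp
  · rcases neg_one_pow_eq_or ℤ (sb a b + tb a b * (l : ℕ)) with h | h <;> simp [h]

/-- **the term sign of phase `j` at any level is `chi j`** (the parity bits `t` of each phase's three cells sum to an even number). -/
theorem termSign_phase (K' : ℕ) (k : ℕ) (hk : k / 8 ≤ K') :
    termSign (es (K' + 5)) (sg (ph k), cl K' k hk) = chi (ph k) := by
  -- reduce to the eight phases with a symbolic level `q = k / 8`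
  have key : ∀ (j : Fin 8) (q : ℕ) (c : Fin 3 → Fin (K' + 5)), (∀ b, ((c b : Fin (K' + 5)) : ℕ) = q + co j b) →
      termSign (es (K' + 5)) (sg j, c) = chi j := by
    intro j q c hc
    unfold termSign
    rw [Fin.prod_univ_three]
    simp only [sign_sg, sg_apply, es, hc]
    fin_cases j <;>
      simp [sgv, sgn, sb, tb, co, chi, pow_add] <;>
      (rcases neg_one_pow_eq_or ℤ q with h | h <;> try simp [h])
  exact key (ph k) (k / 8) (cl K' k hk) (fun b => rfl)

/-- consecutive term signs alternate. -/
theorem chi_alt (k : ℕ) : chi (ph k) * chi (ph (k + 1)) < 0 := by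
  have h8 : ∀ j : Fin 8, chi j * chi (j + 1) < 0 := by decide
  have hph : ph (k + 1) = ph k + 1 := by
    apply Fin.ext; simp only [ph, Fin.val_add]; omega
  rw [hph]; exact h8 (ph k)

/-- **The signed chain**: for every `K'`, the signed design of format `(3, K'+5)` has an ALTERNATING chain of `8(K'+1)` uniquely dominant
terms at strictly increasing integer slopes. -/
theorem threeRowEight_alternating (K' : ℕ) :
    ∃ (d : Fin (K' + 5) → ℕ) (v ε : Fin 3 → Fin 3 → Fin (K' + 5) → ℤ), (∀ i j l, (ε i j l).natAbs ≤ 1) ∧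
      ∃ (θ : Fin (8 * K' + 7 + 1) → ℤ) (p : Fin (8 * K' + 7 + 1) → Equiv.Perm (Fin 3) × (Fin 3 → Fin (K' + 5))),
        StrictMono θ ∧ (∀ k, IsDominant d v ε (θ k) (p k)) ∧
        ∀ k : Fin (8 * K' + 7), termSign ε (p k.castSucc) * termSign ε (p k.succ) < 0 := by
  have hkK : ∀ k : Fin (8 * K' + 7 + 1), (k : ℕ) / 8 ≤ K' := fun k => by have := k.isLt; omega
  refine ⟨dd (K' + 5), vv (K' + 5), es (K' + 5), es_natAbs_le (K' + 5), fun k => th k,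
    fun k => (sg (ph k), cl K' k (hkK k)), ?_, ?_, ?_⟩
  · intro a b hab
    simp only [th]
    have : (a : ℕ) < (b : ℕ) := hab
    omega
  · intro k
    exact isDominant_of_support _ _ _ _ (es_zero_iff (K' + 5)) _ _ (dominant K' k (hkK k))
  · intro k
    have h1 := termSign_phase K' (k.castSucc : ℕ) (hkK k.castSucc)
    have h2 := termSign_phase K' (k.succ : ℕ) (hkK k.succ)
    simp only [Fin.val_castSucc, Fin.val_succ] at h1 h2 ⊢
    rw [h1, h2]
    exact chi_alt k

end ThreeRowEight

/-- **The `(3,K)` tropical row is at least `8K − 33` for every `K ≥ 5`:** `¬ TropRootLawAt 3 (K'+5) (8K'+6)`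
(for comparison: the symmetric rail gives `6K − 9`; the kernel ceilings are `18K − 53` and `⌊(27K−17)/2⌋`). -/
theorem not_tropRootLawAt_three_family (K' : ℕ) : ¬ TropRootLawAt 3 (K' + 5) (8 * K' + 6) := by
  intro h
  obtain ⟨d, v, ε, hε, θ, p, hθ, hdom, halt⟩ := ThreeRowEight.threeRowEight_alternating K'
  have := h d v ε (8 * K' + 7) θ p hε hθ hdom halt
  omega

end Summit.ValiantsHypothesis.ValiantsHypothesis.Theorems.KPlusLogSqLaw
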